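import Summits.Ventures.Crystal3D.Theorems.StickyWulffConstantTextureBuildMeshV7
import HarnessLib

/-!
# TB-cover, BASE CASE: the risered cover and the v7 mesh of a SINGLE-GRAIN packing (territory-only cover, ZERO slack)
# (lane T, crux `TextureLiminfV5`, stmt-Ventures-23912; registered stub `stub_TB_cover` of `TexShadow` v8.23, the TB leg's only open stub)

HONEST FRAMING. Venture `Summits/Ventures/Crystal3D` (cell `crystal3d-full`), route `route-Ventures-StickyWulffConstant`, helper `--supports` the
law-v5 crux `TextureLiminfV5` (stmt-Ventures-23912).  Census-free, standard axioms.  `stub_TB_cover` asks, for every saturated near-optimal cluster,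
for a `RiseredCover C R₀ N x` (…TextureBuildRiseredCover) AND a `Mesh₇` of it (…TextureBuildMeshV7) with
`tilingLoss₂ + rimSum + gapCost ≤ θ·N^{2/3} + unownedSlack₃`.  The interface was patched seven times (CellCover → CrustedCover → RiseredCover; Mesh v1 …
v7, some 70 fields) WITHOUT ever being instantiated.  This file instantiates it in the BASE CASE of the constructor — a packing all of whose balls lie on
ONE moved Barlow stacking `S` (a single grain: no walls, no crusts, no risers, no gap pieces):

* `boxH c w` — the H-representation of the open axis box `{y | ∀ t, c t − w < y t < c t + w}` (`mem_polytope_boxH`, unit normals, bounded, closure in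
  the closed box, frontier on a face);
* `grainTent` — the ONE tent piece: `(L, s, σ)`, tent set `Xh := all balls` (no phantoms), free zone `U := D ∖ closure Core` with the TERRITORY `D` = the
  big box `boxH 0 (bound x + 3)` (every ball is `≥ 3` inside it, so its frontier is EMPTY in the sense of `Mesh₃.hbdry`) and the fiat-solid CORE = the small
  box `boxH c₀ (1/4)` around a ball `c₀` whose `S`-sites within `3` are all occupied (so the collar clause `hcollar₃` holds);
* **`singleGrainCover`** (`RiseredCover C R₀ N x`, any `C R₀`: `x' = x`, one tent, `nk = nc = nr = 0`) and **`singleGrainMesh`** (`Mesh₇` of it, any `δ` for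
  which the caller supplies the MASS COUNT `(1 − δ)N ≤ #{balls all of whose S-sites within 2√2 are balls}`, `gapArea = 0`);
* **`singleGrain_slack`**: `tilingLoss₂ + rimSum + gapCost = 0` — hence `≤ θ·N^{2/3} + unownedSlack₃` for every `θ ≥ 0` (`singleGrain_slack_le`).
Every field of the interface is discharged (most vacuously), i.e. the seven-times-patched binder of `stub_TB_cover` / `stub_TB_energy` is CONSISTENT and
is met with zero slack in the interior of a grain; the asymptotic wrapper in the stub's own quantifier shape (mass count and solid ball from the
deficiency bound `6N − b ≤ K N^{2/3}` via `mem_of_perfect_near`) is the sequel '…TextureBuildSingleGrainTBCover'.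
WHAT THIS IS NOT: no wall cell, crust, riser or gap piece is built — the multi-grain constructor (grains of the Barlow resolution, wall cells at a good scale,
riser boxes on coherent boundaries) is the open content of `stub_TB_cover`; F-C1 not moved.
-/

noncomputable section

open scoped BigOperators InnerProductSpace
open MeasureTheory

namespace Summit.Ventures.Crystal3D.Cruxes.TextureLiminf.TexShadow

open Summit.Ventures.Crystal3D Summit.Ventures.Crystal3D.Theorems
open Literature.MathematicalPhysics.StatisticalMechanics (IsHaggSeq)

/-! ## Axis boxes as H-polytopes -/

/-- the H-representation of the open axis box `{y | ∀ t, c t − w < y t < c t + w}`: normals `± e_t`. -/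
def boxH (c : E3) (w : ℝ) : Finset (E3 × ℝ) :=
  Finset.univ.image (fun t : Fin 3 => ((EuclideanSpace.single t (1 : ℝ) : E3), c t + w)) ∪
    Finset.univ.image (fun t : Fin 3 => (-(EuclideanSpace.single t (1 : ℝ) : E3), w - c t))

/-- Box data have unit normals. -/
theorem boxH_unit (c : E3) (w : ℝ) : ∀ p ∈ boxH c w, ‖p.1‖ = 1 := by
  intro p hp
  simp only [boxH, Finset.mem_union, Finset.mem_image, Finset.mem_univ, true_and] at hp
  rcases hp with ⟨t, rfl⟩ | ⟨t, rfl⟩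
  · simp
  · simp

/-- Membership in the open box. -/
theorem mem_polytope_boxH {c : E3} {w : ℝ} {y : E3} :
    y ∈ polytope (boxH c w) ↔ ∀ t, c t - w < y t ∧ y t < c t + w := by
  simp only [polytope, boxH, Set.mem_iInter, Set.mem_setOf_eq, Finset.mem_union, Finset.mem_image, Finset.mem_univ,
    true_and]
  constructor
  · intro h t
    have h1 := h _ (Or.inl ⟨t, rfl⟩)
    have h2 := h _ (Or.inr ⟨t, rfl⟩)
    simp only [EuclideanSpace.inner_single_left, map_one, one_mul, inner_neg_left] at h1 h2
    exact ⟨by linarith, h1⟩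
  · rintro h p (⟨t, rfl⟩ | ⟨t, rfl⟩)
    · simp only [EuclideanSpace.inner_single_left, map_one, one_mul]
      exact (h t).2
    · simp only [inner_neg_left, EuclideanSpace.inner_single_left, map_one, one_mul]
      linarith [(h t).1]

/-- The closure of the open box lies in the closed box. -/
theorem closure_polytope_boxH {c : E3} {w : ℝ} {y : E3} (hy : y ∈ closure (polytope (boxH c w))) :
    ∀ t, c t - w ≤ y t ∧ y t ≤ c t + w := by
  have hcl : IsClosed {y : E3 | ∀ t, c t - w ≤ y t ∧ y t ≤ c t + w} := by
    have : {y : E3 | ∀ t, c t - w ≤ y t ∧ y t ≤ c t + w} = ⋂ t, ({y : E3 | c t - w ≤ y t} ∩ {y | y t ≤ c t + w}) := by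
      ext y; simp only [Set.mem_setOf_eq, Set.mem_iInter, Set.mem_inter_iff]
    rw [this]
    refine isClosed_iInter fun t => IsClosed.inter ?_ ?_
    · exact isClosed_le continuous_const ((EuclideanSpace.proj t).continuous)
    · exact isClosed_le ((EuclideanSpace.proj t).continuous) continuous_const
  have hsub : polytope (boxH c w) ⊆ {y : E3 | ∀ t, c t - w ≤ y t ∧ y t ≤ c t + w} := by
    intro z hz t
    have := (mem_polytope_boxH.1 hz) t
    exact ⟨this.1.le, this.2.le⟩
  exact (closure_minimal hsub hcl) hy

/-- Coordinates are `1`-Lipschitz: `|y t − z t| ≤ dist y z`. -/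
theorem abs_sub_apply_le_dist (y z : E3) (t : Fin 3) : |y t - z t| ≤ dist y z := by
  have h := PiLp.dist_apply_le y z t
  rwa [Real.dist_eq] at h

/-- A point of the closed box is within `2w` of its centre. -/
theorem dist_le_of_box {c : E3} {w : ℝ} (hw : 0 ≤ w) {y : E3} (hy : ∀ t, c t - w ≤ y t ∧ y t ≤ c t + w) :
    dist y c ≤ 2 * w := by
  rw [EuclideanSpace.dist_eq]
  have hterm : ∀ t, dist (y t) (c t) ^ 2 ≤ w ^ 2 := by
    intro t
    rw [Real.dist_eq, sq_abs]
    have h1 := (hy t).1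
    have h2 := (hy t).2
    nlinarith
  have hsum : ∑ t, dist (y t) (c t) ^ 2 ≤ (2 * w) ^ 2 := by
    calc ∑ t, dist (y t) (c t) ^ 2 ≤ ∑ _t : Fin 3, w ^ 2 := Finset.sum_le_sum fun t _ => hterm t
      _ = 3 * w ^ 2 := by simp
      _ ≤ (2 * w) ^ 2 := by nlinarith
  calc Real.sqrt (∑ t, dist (y t) (c t) ^ 2) ≤ Real.sqrt ((2 * w) ^ 2) := Real.sqrt_le_sqrt hsum
    _ = 2 * w := Real.sqrt_sq (by linarith)

/-- The open box is bounded. -/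
theorem isBounded_polytope_boxH (c : E3) (w : ℝ) : Bornology.IsBounded (polytope (boxH c w)) := by
  rcases le_or_gt 0 w with hw | hw
  · refine (Metric.isBounded_closedBall (x := c) (r := 2 * w)).subset fun y hy => ?_
    rw [Metric.mem_closedBall]
    exact dist_le_of_box hw fun t => ⟨((mem_polytope_boxH.1 hy) t).1.le, ((mem_polytope_boxH.1 hy) t).2.le⟩
  · have : polytope (boxH c w) = ∅ := by
      ext y
      simp only [Set.mem_empty_iff_false, iff_false]
      intro hy
      have := (mem_polytope_boxH.1 hy) 0
      linarith [this.1, this.2]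
    rw [this]; exact Bornology.isBounded_empty

/-- The open box is open. -/
theorem isOpen_polytope_boxH (c : E3) (w : ℝ) : IsOpen (polytope (boxH c w)) := by
  unfold polytope
  exact isOpen_biInter_finset fun q _ => isOpen_lt (continuous_const.inner continuous_id) continuous_const

/-- A frontier point of the open box lies in the closed box and ON A FACE. -/
theorem frontier_polytope_boxH {c : E3} {w : ℝ} {y : E3} (hy : y ∈ frontier (polytope (boxH c w))) :
    (∀ t, c t - w ≤ y t ∧ y t ≤ c t + w) ∧ ∃ t, y t = c t - w ∨ y t = c t + w := by
  rw [frontier, (isOpen_polytope_boxH c w).interior_eq] at hy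
  have hcl := closure_polytope_boxH hy.1
  refine ⟨hcl, ?_⟩
  by_contra hne
  push Not at hne
  apply hy.2
  rw [mem_polytope_boxH]
  intro t
  exact ⟨lt_of_le_of_ne (hcl t).1 (fun h => (hne t).1 h.symm), lt_of_le_of_ne (hcl t).2 (hne t).2⟩

/-! ## The single grain: data -/

section SingleGrain

variable {N : ℕ} {x : Fin N → E3}

/-- a radius bound of the configuration: every coordinate of every ball is at most `bound x` in absolute value -/
def bound (x : Fin N → E3) : ℝ := ∑ i, ‖x i‖

/-- `bound x ≥ 0`. -/
theorem bound_nonneg (x : Fin N → E3) : 0 ≤ bound x := Finset.sum_nonneg fun _ _ => norm_nonneg _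

/-- Every coordinate of every ball is bounded by `bound x`. -/
theorem abs_apply_le_bound (x : Fin N → E3) (i : Fin N) (t : Fin 3) : |x i t| ≤ bound x := by
  calc |x i t| = ‖x i t‖ := (Real.norm_eq_abs _).symm
    _ ≤ ‖x i‖ := PiLp.norm_apply_le (x i) t
    _ ≤ bound x := Finset.single_le_sum (f := fun j => ‖x j‖) (fun j _ => norm_nonneg _) (Finset.mem_univ i)

/-- the TERRITORY of the grain: the big open box -/
def bigBox (x : Fin N → E3) : Finset (E3 × ℝ) := boxH 0 (bound x + 3)

/-- the fiat-solid CORE of the grain: the small open box around the solid ball `c₀` -/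
def coreBox (c₀ : E3) : Finset (E3 × ℝ) := boxH c₀ (1 / 4)

/-- the FREE ZONE: territory minus closed core (in the `⋃ j : Fin 1` shape of `Mesh₃.hU`) -/
def freeZone (x : Fin N → E3) (c₀ : E3) : Set E3 :=
  (⋃ _j : Fin 1, polytope (bigBox x)) \ closure (⋃ _j : Fin 1, polytope (coreBox c₀))

/-- The free zone is open. -/
theorem isOpen_freeZone (x : Fin N → E3) (c₀ : E3) : IsOpen (freeZone x c₀) :=
  (isOpen_iUnion fun _ => isOpen_polytope_boxH _ _).sdiff isClosed_closure

/-- A ball's `√2`-neighbourhood (indeed its `3`-neighbourhood) lies in the territory. -/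
theorem mem_polytope_bigBox_of_dist_lt (i : Fin N) {z : E3} (hz : dist z (x i) < 3) : z ∈ polytope (bigBox x) := by
  rw [bigBox, mem_polytope_boxH]
  intro t
  have h1 := abs_sub_apply_le_dist z (x i) t
  have h2 := abs_apply_le_bound x i t
  have h3 : |z t - x i t| < 3 := lt_of_le_of_lt h1 hz
  rw [abs_lt] at h3
  rw [abs_le] at h2
  have h0 : (0 : E3) t = 0 := rfl
  rw [h0]
  constructor <;> linarith [h3.1, h3.2, h2.1, h2.2]

/-- Balls are `√2`-far (indeed `3`-far) from the frontier of the territory. -/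
theorem dist_ge_three_of_frontier_bigBox {y : E3} (hy : y ∈ frontier (polytope (bigBox x))) (i : Fin N) : 3 ≤ dist y (x i) := by
  obtain ⟨-, t, ht⟩ := frontier_polytope_boxH hy
  have h1 := abs_sub_apply_le_dist y (x i) t
  have h2 := abs_apply_le_bound x i t
  rw [abs_le] at h2
  have h0 : (0 : E3) t = 0 := rfl
  rw [h0] at ht
  refine le_trans ?_ h1
  rw [le_abs]
  rcases ht with ht | ht <;> [right; left] <;> linarith [h2.1, h2.2]

/-- The closed core lies within `1/2` of its centre. -/
theorem dist_le_half_of_closure_coreBox {c₀ y : E3} (hy : y ∈ closure (polytope (coreBox c₀))) : dist y c₀ ≤ 1 / 2 := by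
  have := dist_le_of_box (by norm_num : (0 : ℝ) ≤ 1 / 4) (closure_polytope_boxH hy)
  linarith

/-- The core contains its centre. -/
theorem mem_polytope_coreBox (c₀ : E3) : c₀ ∈ polytope (coreBox c₀) := by
  rw [coreBox, mem_polytope_boxH]
  intro t; constructor <;> linarith

/-- The core of a ball lies in the territory. -/
theorem polytope_coreBox_subset (i₀ : Fin N) : polytope (coreBox (x i₀)) ⊆ polytope (bigBox x) := by
  intro y hy
  refine mem_polytope_bigBox_of_dist_lt i₀ ?_
  have := dist_le_of_box (by norm_num : (0 : ℝ) ≤ 1 / 4) fun t => ⟨((mem_polytope_boxH.1 hy) t).1.le, ((mem_polytope_boxH.1 hy) t).2.le⟩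
  linarith

/-- A frontier point of the territory is not in the closed core of a ball. -/
theorem not_mem_closure_coreBox_of_frontier {y : E3} (hy : y ∈ frontier (polytope (bigBox x))) (i₀ : Fin N) :
    y ∉ closure (polytope (coreBox (x i₀))) := by
  intro h
  have h1 := dist_le_half_of_closure_coreBox h
  have h2 := dist_ge_three_of_frontier_bigBox hy i₀
  linarith

variable {L : E3 ≃ₗᵢ[ℝ] E3} {s : E3} {σ : ℤ → ℤ}

/-- **THE TENT PIECE of the single grain**: the stacking, ALL balls as the tent set (no phantoms), free zone = territory minus closed core. -/
def grainTent (hσ : IsHaggSeq σ) (hS : ∀ i, x i ∈ stacking L s σ) (c₀ : E3) : TentPiece where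
  L := L
  s := s
  σ := σ
  hσ := hσ
  Xh := Finset.univ.image x
  hXh := by
    intro b hb
    rw [Finset.mem_coe, Finset.mem_image] at hb
    obtain ⟨i, -, rfl⟩ := hb
    exact hS i
  U := freeZone x c₀
  hU := isOpen_freeZone x c₀

/-! ## The single grain: the risered cover (one tent, nothing else) -/

/-- **THE RISERED COVER OF A SINGLE-GRAIN PACKING** (any constants `C, R₀`): the configuration itself (`x' = x`), ONE tent piece, no wall cells,
no crust cells, no riser pieces. -/
def singleGrainCover (C R₀ : ℝ) (hx : IsUnitPacking x) (hσ : IsHaggSeq σ) (hS : ∀ i, x i ∈ stacking L s σ) (c₀ : E3) :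
    RiseredCover C R₀ N x where
  N' := N
  x' := x
  hx' := hx
  hsub := subset_rfl
  hDef := le_rfl
  ng := 1
  tent := fun _ => grainTent hσ hS c₀
  nk := 0
  cell := fun k => k.elim0
  hdisjTT := fun f g hfg => absurd (Subsingleton.elim f g) hfg
  hdisjTC := fun _ k => k.elim0
  hdisjCC := fun k => k.elim0
  nc := 0
  tf := fun c => c.elim0
  cP := fun c => c.elim0
  cB := fun c => c.elim0
  cQ := fun c => c.elim0
  cA := fun c => c.elim0
  hcP := fun c => c.elim0
  hcB := fun c => c.elim0
  hcQ := fun c => c.elim0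
  hadh := fun c => c.elim0
  hBB := fun c => c.elim0
  hBT := fun c => c.elim0
  hBC := fun c => c.elim0
  nr := 0
  rtL := fun r => r.elim0
  rtR := fun r => r.elim0
  hrt := fun r => r.elim0
  rn := fun r => r.elim0
  hrn := fun r => r.elim0
  rown := fun r => r.elim0
  hrown := fun r => r.elim0
  rV := fun r => r.elim0
  hrV6 := fun r => r.elim0
  hrplanes := fun r => r.elim0
  hrin := fun r => r.elim0
  hRR := fun r => r.elim0
  hRT := fun r => r.elim0
  hRB := fun r => r.elim0
  hRC := fun r => r.elim0

variable {C R₀ : ℝ} (hx : IsUnitPacking x) (hσ : IsHaggSeq σ) (hS : ∀ i, x i ∈ stacking L s σ) (c₀ : E3)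

/-- The filled configuration of the single-grain cover is the tent set. -/
theorem singleGrainCover_X' : (singleGrainCover C R₀ hx hσ hS c₀).X' = Finset.univ.image x := rfl

/-- The tent set of the single grain is the configuration. -/
theorem singleGrainCover_Xh (f : Fin 1) : ((singleGrainCover C R₀ hx hσ hS c₀).tent f).Xh = Finset.univ.image x := rfl

/-- There are no wall cells. -/
theorem singleGrainCover_nk_isEmpty : IsEmpty (Fin (singleGrainCover C R₀ hx hσ hS c₀).nk) := Fin.isEmpty'

/-- There are no crust cells. -/
theorem singleGrainCover_nc_isEmpty : IsEmpty (Fin (singleGrainCover C R₀ hx hσ hS c₀).nc) := Fin.isEmpty'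

/-- There are no riser pieces. -/
theorem singleGrainCover_nr_isEmpty : IsEmpty (Fin (singleGrainCover C R₀ hx hσ hS c₀).nr) := Fin.isEmpty'

/-- There is one tent piece. -/
theorem singleGrainCover_ng_subsingleton : Subsingleton (Fin (singleGrainCover C R₀ hx hσ hS c₀).ng) :=
  inferInstanceAs (Subsingleton (Fin 1))

/-- `rimSum = 0` (no wall cells). -/
theorem singleGrainCover_rimSum : (singleGrainCover C R₀ hx hσ hS c₀).rimSum = 0 := by
  haveI := singleGrainCover_nk_isEmpty (C := C) (R₀ := R₀) hx hσ hS c₀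
  unfold CellCover.rimSum
  exact Finset.sum_of_isEmpty _

/-- `crossCount A ∅ = 0`. -/
theorem crossCount_empty_right (A : Finset E3) : crossCount A ∅ = 0 := by
  unfold crossCount; simp

/-- The sharp tent rim of the single grain vanishes (no phantoms, no foreign balls). -/
theorem singleGrainCover_tentRimSharp (f : Fin 1) : (singleGrainCover C R₀ hx hσ hS c₀).tentRimSharp f = 0 := by
  unfold CrustedCover.tentRimSharp
  have h1 : (singleGrainCover C R₀ hx hσ hS c₀).X' \ ((singleGrainCover C R₀ hx hσ hS c₀).tent f).Xh = ∅ := by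
    rw [singleGrainCover_X', singleGrainCover_Xh, Finset.sdiff_self]
  have h2 : ((singleGrainCover C R₀ hx hσ hS c₀).tent f).Xh \ (singleGrainCover C R₀ hx hσ hS c₀).X' = ∅ := by
    rw [singleGrainCover_X', singleGrainCover_Xh, Finset.sdiff_self]
  rw [h1, h2, crossCount_empty_right, Finset.filter_empty, Finset.sum_empty]
  simp

/-- `tilingLoss₂ = 0` for the single grain. -/
theorem singleGrainCover_tilingLoss₂ : (singleGrainCover C R₀ hx hσ hS c₀).tilingLoss₂ = 0 := by
  unfold CrustedCover.tilingLoss₂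
  have h0 : ∑ f, (singleGrainCover C R₀ hx hσ hS c₀).tentRimSharp f = 0 :=
    Finset.sum_eq_zero fun f _ => singleGrainCover_tentRimSharp (C := C) (R₀ := R₀) hx hσ hS c₀ f
  rw [h0]
  haveI := singleGrainCover_nk_isEmpty (C := C) (R₀ := R₀) hx hσ hS c₀
  haveI := singleGrainCover_nc_isEmpty (C := C) (R₀ := R₀) hx hσ hS c₀
  have h1 : ∑ c, (singleGrainCover C R₀ hx hσ hS c₀).crustTerm c = 0 := Finset.sum_of_isEmpty _
  have h2 : ∑ c, (singleGrainCover C R₀ hx hσ hS c₀).crustRim c = 0 := Finset.sum_of_isEmpty _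
  have h3 : ∑ k, ((singleGrainCover C R₀ hx hσ hS c₀).cell k).tilingRim = 0 := Finset.sum_of_isEmpty _
  rw [h1, h2, h3]; ring

end SingleGrain

end Summit.Ventures.Crystal3D.Cruxes.TextureLiminf.TexShadow

end
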